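import Summits.Ventures.PercRepro.RankLevelSetHallRuleQ

/-!
# PercRepro — Rule Q at the tight layer: the CO-INDEPENDENCE LEMMA of the swap count (night-1, gen 13)

For a member `Z` of the cell `(p, q)` (`r(Z) = q`, `r(E ∖ Z) = p`) split its complement into the FLAT PART
`P = (E ∖ Z) ∩ cl Z` and the FREE PART `D = (E ∖ Z) ∖ cl Z`.  A second member `Z′` (a «swap» of `Z`: `Z′ = (Z ∖ Y₁) ∪ Y₂`)
has a complement of rank `p` contained in `cl Z ∪ (D ∖ Z′)`, so `D ∖ Z′` still carries rank `p − q` over `cl Z`: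
at the tight layer `#E = p + q` this bounds the number of elements of `D` that any member can use,
`#(Z′ ∩ D) + #P ≤ q` (`ncard_inter_freePart_add_ncard_flatPart_le`) — the ONE matroid fact behind the reduction of Rule Q
(dossier §23.8 (C)) to the binomial inequality (R̂): with `m = #P` a member inside `Z ∪ X_P ∪ X_D` swaps at most `q − m`
elements of `X_D ⊆ D` in, which is what truncates the swap count `m̂(q,m;a,j)` at `t_D ≤ q − m`.

* `flatPart`, `freePart` — `P` and `D`;
* `compl_subset_closure_union_freePart_diff` — `E ∖ Z′ ⊆ cl Z ∪ (D ∖ Z′)` for `Z′ ⊆ E`;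
* **`eRk_closure_union_freePart_diff`** — `p ≤ r(cl Z ∪ (D ∖ Z′))` for members `Z, Z′`;
* **`ncard_inter_freePart_add_ncard_flatPart_le`** — at `#E = p + q`: `#(Z′ ∩ D) + #P ≤ q`.
Axioms: standard.
-/

namespace PercRepro

open Set Matroid

variable {α : Type} (M : Matroid α)

/-- `P`: the part of the complement of `Z` lying in the closure of `Z`. -/
def flatPart (Z : Set α) : Set α := (M.E \ Z) ∩ M.closure Z

/-- `D`: the part of the complement of `Z` outside the closure of `Z`. -/
def freePart (Z : Set α) : Set α := (M.E \ Z) \ M.closure Z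

/-- The complement of any `Z′ ⊆ E` lies in `cl Z ∪ (D ∖ Z′)`. -/
lemma compl_subset_closure_union_freePart_diff (Z Z' : Set α) (hZ : Z ⊆ M.E) :
    M.E \ Z' ⊆ M.closure Z ∪ (freePart M Z \ Z') := by
  intro x hx
  obtain ⟨hxE, hxZ'⟩ := hx
  by_cases hcl : x ∈ M.closure Z
  · exact Or.inl hcl
  · right
    have hxZ : x ∉ Z := fun hxZ => hcl (M.subset_closure Z hZ hxZ)
    exact ⟨⟨⟨hxE, hxZ⟩, hcl⟩, hxZ'⟩

/-- **The co-independence lemma**: for members `Z`, `Z′` of the cell `(p, q)`, the set `D ∖ Z′` still carries rank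
`p` together with `cl Z`. -/
theorem eRk_closure_union_freePart_diff {p q : ℕ} {Z Z' : Set α} (hZ : Z ∈ cellMembers M p q)
    (hZ' : Z' ∈ cellMembers M p q) :
    (p : ℕ∞) ≤ M.eRk (M.closure Z ∪ (freePart M Z \ Z')) := by
  have h := M.eRk_mono (compl_subset_closure_union_freePart_diff M Z Z' hZ.1)
  rw [hZ'.2.2] at h
  exact h

variable [M.Finite]

/-- `D` and `P` partition `E ∖ Z`, and `#(E ∖ Z) = p` at the tight layer. -/
lemma ncard_freePart_add_ncard_flatPart {p q : ℕ} (hE : M.E.ncard = p + q) {Z : Set α}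
    (hZ : Z ∈ cellMembers M p q) : (freePart M Z).ncard + (flatPart M Z).ncard = p := by
  have hfin : (M.E \ Z).Finite := M.ground_finite.subset sdiff_subset
  have hsplit := ncard_inter_add_ncard_sdiff_eq_ncard (M.E \ Z) (M.closure Z) hfin
  obtain ⟨-, hcard⟩ := compl_indep_of_mem_U M hE hZ
  unfold freePart flatPart
  rw [add_comm]
  rw [hcard] at hsplit
  exact hsplit

/-- **At the tight layer a member uses at most `q − #P` elements of `D`**: for members `Z, Z′` of the cell `(p, q)`
with `#E = p + q`, `#(Z′ ∩ D) + #P ≤ q`. -/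
theorem ncard_inter_freePart_add_ncard_flatPart_le {p q : ℕ} (hE : M.E.ncard = p + q) {Z Z' : Set α}
    (hZ : Z ∈ cellMembers M p q) (hZ' : Z' ∈ cellMembers M p q) :
    (Z' ∩ freePart M Z).ncard + (flatPart M Z).ncard ≤ q := by
  have hDfin : (freePart M Z).Finite := M.ground_finite.subset (fun x hx => hx.1.1)
  -- rank bound: p ≤ r(cl Z ∪ (D ∖ Z′)) ≤ r(cl Z) + #(D ∖ Z′) = q + #(D ∖ Z′)
  have h1 := eRk_closure_union_freePart_diff M hZ hZ'
  have h2 := M.eRk_union_le_eRk_add_encard (M.closure Z) (freePart M Z \ Z')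
  rw [M.eRk_closure_eq, hZ.2.1, ← (hDfin.subset sdiff_subset).cast_ncard_eq] at h2
  have h3 : (p : ℕ∞) ≤ (q : ℕ∞) + ((freePart M Z \ Z').ncard : ℕ∞) := h1.trans h2
  have h3' : p ≤ q + (freePart M Z \ Z').ncard := by exact_mod_cast h3
  -- #(D ∖ Z′) + #(D ∩ Z′) = #D
  have h4 := ncard_inter_add_ncard_sdiff_eq_ncard (freePart M Z) Z' hDfin
  have h5 := ncard_freePart_add_ncard_flatPart M hE hZ
  have h6 : (Z' ∩ freePart M Z).ncard = (freePart M Z ∩ Z').ncard := by rw [inter_comm]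
  omega

end PercRepro
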